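import Mathlib
import Literature.NumberTheory.LFunctions.Zhang2022.Section7aStatements
import HarnessLib

/-!
# Zhang (2022) §7 Prop. 7.1 p. 34: the arithmetic sums `S_j(𝐚₁,𝐚₂)` are bilinear in `(𝐚₁,𝐚₂)`

Topic `Literature/NumberTheory/LFunctions/Zhang2022` (Landau–Siegel audit tree; verdict-neutral).
Y. Zhang, *Discrete mean estimates and the Landau–Siegel zero*, arXiv:2211.02515v1 (2022)
[Zhang2022LandauSiegel] — **an unrefereed manuscript under adjudication; nothing in this file
asserts or denies its Theorems 1–2.** THEOREMS ONLY (no definition, no claim of the manuscript).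

Proposition 7.1 (§7 p. 33–34, tex L1845) prices the mean value `Θ₁(𝐚₁,𝐚₂)` by the main term
`α⁻¹(½S₁+2S₂+3/2S₃)𝔓` and the error `E(𝐚₁,𝐚₂) = 𝔓𝓛²Σ_j|S_j(𝐚₁,𝐚₂)|`, where (banked object
`Skeleton.Sj`, all sums finite, `Section7aStatements.Sj_def`)

  `S_j(𝐚₁,𝐚₂) = Σ_d Σ_r |μ(r)|λ₀ⱼ(dr)/(drφ(r)) · (Σ_m a₁(drm)m^{−(1−β_j)}) · (Σ_n a₂(drn)ξ₀ⱼ(n;d,r)/n)`.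

The `m`-sum is linear in `𝐚₁` and the `n`-sum is linear in `𝐚₂`, so `S_j` is BILINEAR. Every
absolute-value estimate of a window mean square in §§11–12 (the `hS`-type inputs of
`Typed.Sec12A.eq126_of_sj_small` / `eq128_of_sj_small`, the §11 window leaves) splits its
coefficient sequence into pieces (`𝐛 = 𝐛_in + 𝐛_near + 𝐛_far`, bulk/edge/sharp parts, …) and
prices the pairs separately; this file records the bookkeeping identities once, by name:

* `Sj_add_left/right`, `Sj_sub_left/right`, `Sj_neg_left/right`, `Sj_zero_left/right`,
  `Sj_smul_left/right` (`S_j(z•𝐚₁,𝐚₂) = z·S_j(𝐚₁,𝐚₂)`), `Sj_sum_left/right` (finite families);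
* lambda forms `Sj_add_left'/right'`, `Sj_sub_left'/right'`;
* indicator splits `Sj_ite_split_left/right`: `S_j(𝐚₁,𝐚₂) = S_j(𝐚₁𝟙_p,𝐚₂) + S_j(𝐚₁𝟙_{¬p},𝐚₂)`
  for any decidable predicate `p` on `ℕ`, and the same in the second slot;
* `Sj_add_add` (both slots at once: four terms).

Deliberately NOT here: any BOUND for `S_j` (tree: `XiZeroMajorant.norm_Sj_le_of_bounds`,
`WindowSj.norm_Sj_window_le`, `SjWindow.norm_Sj_window_le`, `SjWindowEngine.window_triple_sum_le`).
0 definitions; standard axioms. No statement about Landau–Siegel zeros is made or implied.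

## References

* Y. Zhang, arXiv:2211.02515v1 (2022), §7 Prop. 7.1 p. 33–34 (tex L1845).
  [cite: Zhang2022LandauSiegel, §7 Prop. 7.1 p.34]
-/

noncomputable section

open Complex Finset

namespace Literature.NumberTheory.LFunctions.Zhang2022.Skeleton

/-! ### Additivity -/

/-- **`S_j` is additive in the first sequence**: `S_j(𝐚₁+𝐛₁,𝐚₂) = S_j(𝐚₁,𝐚₂) + S_j(𝐛₁,𝐚₂)`
(the `m`-sum of Prop. 7.1's `S_j` is linear in `𝐚₁`). [cite: Zhang2022LandauSiegel, §7 Prop. 7.1 p.34] -/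
theorem Sj_add_left (c' : ℝ) (D j : ℕ) (a₁ b₁ a₂ : ℕ → ℂ) :
    Sj c' D j (a₁ + b₁) a₂ = Sj c' D j a₁ a₂ + Sj c' D j b₁ a₂ := by
  unfold Sj
  rw [← Finset.sum_add_distrib]
  refine Finset.sum_congr rfl fun d _ => ?_
  rw [← Finset.sum_add_distrib]
  refine Finset.sum_congr rfl fun r _ => ?_
  have : ∑ m ∈ Ico 1 (Nsupp D), (a₁ + b₁) (d * r * m) / (m : ℂ) ^ (1 - betaJ c' D j) =
      ∑ m ∈ Ico 1 (Nsupp D), a₁ (d * r * m) / (m : ℂ) ^ (1 - betaJ c' D j) +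
        ∑ m ∈ Ico 1 (Nsupp D), b₁ (d * r * m) / (m : ℂ) ^ (1 - betaJ c' D j) := by
    rw [← Finset.sum_add_distrib]
    exact Finset.sum_congr rfl fun m _ => by rw [Pi.add_apply, add_div]
  rw [this]; ring

/-- **`S_j` is additive in the second sequence**: `S_j(𝐚₁,𝐚₂+𝐛₂) = S_j(𝐚₁,𝐚₂) + S_j(𝐚₁,𝐛₂)`
(the `n`-sum of Prop. 7.1's `S_j` is linear in `𝐚₂`). [cite: Zhang2022LandauSiegel, §7 Prop. 7.1 p.34] -/
theorem Sj_add_right (c' : ℝ) (D j : ℕ) (a₁ a₂ b₂ : ℕ → ℂ) :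
    Sj c' D j a₁ (a₂ + b₂) = Sj c' D j a₁ a₂ + Sj c' D j a₁ b₂ := by
  unfold Sj
  rw [← Finset.sum_add_distrib]
  refine Finset.sum_congr rfl fun d _ => ?_
  rw [← Finset.sum_add_distrib]
  refine Finset.sum_congr rfl fun r _ => ?_
  have : ∑ n ∈ Ico 1 (Nsupp D), (a₂ + b₂) (d * r * n) * xiZero c' D j n d r / (n : ℂ) =
      ∑ n ∈ Ico 1 (Nsupp D), a₂ (d * r * n) * xiZero c' D j n d r / (n : ℂ) +
        ∑ n ∈ Ico 1 (Nsupp D), b₂ (d * r * n) * xiZero c' D j n d r / (n : ℂ) := by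
    rw [← Finset.sum_add_distrib]
    exact Finset.sum_congr rfl fun n _ => by rw [Pi.add_apply, add_mul, add_div]
  rw [this]; ring

/-! ### Homogeneity -/

/-- **`S_j` is homogeneous in the first sequence**: `S_j(z•𝐚₁,𝐚₂) = z·S_j(𝐚₁,𝐚₂)`.
[cite: Zhang2022LandauSiegel, §7 Prop. 7.1 p.34] -/
theorem Sj_smul_left (c' : ℝ) (D j : ℕ) (z : ℂ) (a₁ a₂ : ℕ → ℂ) :
    Sj c' D j (z • a₁) a₂ = z * Sj c' D j a₁ a₂ := by
  unfold Sj
  rw [Finset.mul_sum]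
  refine Finset.sum_congr rfl fun d _ => ?_
  rw [Finset.mul_sum]
  refine Finset.sum_congr rfl fun r _ => ?_
  have : ∑ m ∈ Ico 1 (Nsupp D), (z • a₁) (d * r * m) / (m : ℂ) ^ (1 - betaJ c' D j) =
      z * ∑ m ∈ Ico 1 (Nsupp D), a₁ (d * r * m) / (m : ℂ) ^ (1 - betaJ c' D j) := by
    rw [Finset.mul_sum]
    exact Finset.sum_congr rfl fun m _ => by rw [Pi.smul_apply, smul_eq_mul, mul_div_assoc]
  rw [this]; ring

/-- **`S_j` is homogeneous in the second sequence**: `S_j(𝐚₁,z•𝐚₂) = z·S_j(𝐚₁,𝐚₂)`.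
[cite: Zhang2022LandauSiegel, §7 Prop. 7.1 p.34] -/
theorem Sj_smul_right (c' : ℝ) (D j : ℕ) (z : ℂ) (a₁ a₂ : ℕ → ℂ) :
    Sj c' D j a₁ (z • a₂) = z * Sj c' D j a₁ a₂ := by
  unfold Sj
  rw [Finset.mul_sum]
  refine Finset.sum_congr rfl fun d _ => ?_
  rw [Finset.mul_sum]
  refine Finset.sum_congr rfl fun r _ => ?_
  have : ∑ n ∈ Ico 1 (Nsupp D), (z • a₂) (d * r * n) * xiZero c' D j n d r / (n : ℂ) =
      z * ∑ n ∈ Ico 1 (Nsupp D), a₂ (d * r * n) * xiZero c' D j n d r / (n : ℂ) := by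
    rw [Finset.mul_sum]
    exact Finset.sum_congr rfl fun n _ => by
      rw [Pi.smul_apply, smul_eq_mul, mul_assoc, mul_div_assoc]
  rw [this]; ring

/-! ### Negation, subtraction, zero -/

/-- `S_j(−𝐚₁,𝐚₂) = −S_j(𝐚₁,𝐚₂)`. [cite: Zhang2022LandauSiegel, §7 Prop. 7.1 p.34] -/
theorem Sj_neg_left (c' : ℝ) (D j : ℕ) (a₁ a₂ : ℕ → ℂ) :
    Sj c' D j (-a₁) a₂ = -Sj c' D j a₁ a₂ := by
  have h := Sj_smul_left c' D j (-1) a₁ a₂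
  rw [neg_one_smul] at h
  rw [h]; ring

/-- `S_j(𝐚₁,−𝐚₂) = −S_j(𝐚₁,𝐚₂)`. [cite: Zhang2022LandauSiegel, §7 Prop. 7.1 p.34] -/
theorem Sj_neg_right (c' : ℝ) (D j : ℕ) (a₁ a₂ : ℕ → ℂ) :
    Sj c' D j a₁ (-a₂) = -Sj c' D j a₁ a₂ := by
  have h := Sj_smul_right c' D j (-1) a₁ a₂
  rw [neg_one_smul] at h
  rw [h]; ring

/-- `S_j(𝐚₁−𝐛₁,𝐚₂) = S_j(𝐚₁,𝐚₂) − S_j(𝐛₁,𝐚₂)`. [cite: Zhang2022LandauSiegel, §7 Prop. 7.1 p.34] -/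
theorem Sj_sub_left (c' : ℝ) (D j : ℕ) (a₁ b₁ a₂ : ℕ → ℂ) :
    Sj c' D j (a₁ - b₁) a₂ = Sj c' D j a₁ a₂ - Sj c' D j b₁ a₂ := by
  rw [sub_eq_add_neg, Sj_add_left, Sj_neg_left, ← sub_eq_add_neg]

/-- `S_j(𝐚₁,𝐚₂−𝐛₂) = S_j(𝐚₁,𝐚₂) − S_j(𝐚₁,𝐛₂)`. [cite: Zhang2022LandauSiegel, §7 Prop. 7.1 p.34] -/
theorem Sj_sub_right (c' : ℝ) (D j : ℕ) (a₁ a₂ b₂ : ℕ → ℂ) :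
    Sj c' D j a₁ (a₂ - b₂) = Sj c' D j a₁ a₂ - Sj c' D j a₁ b₂ := by
  rw [sub_eq_add_neg, Sj_add_right, Sj_neg_right, ← sub_eq_add_neg]

/-- `S_j(0,𝐚₂) = 0`. [cite: Zhang2022LandauSiegel, §7 Prop. 7.1 p.34] -/
theorem Sj_zero_left (c' : ℝ) (D j : ℕ) (a₂ : ℕ → ℂ) : Sj c' D j 0 a₂ = 0 := by
  have h := Sj_smul_left c' D j 0 0 a₂
  rw [zero_smul, zero_mul] at h
  exact h

/-- `S_j(𝐚₁,0) = 0`. [cite: Zhang2022LandauSiegel, §7 Prop. 7.1 p.34] -/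
theorem Sj_zero_right (c' : ℝ) (D j : ℕ) (a₁ : ℕ → ℂ) : Sj c' D j a₁ 0 = 0 := by
  have h := Sj_smul_right c' D j 0 a₁ 0
  rw [zero_smul, zero_mul] at h
  exact h

/-! ### Finite families -/

/-- `S_j(Σᵢ 𝐚ᵢ,𝐚₂) = Σᵢ S_j(𝐚ᵢ,𝐚₂)` for a finite family. [cite: Zhang2022LandauSiegel, §7 Prop. 7.1 p.34] -/
theorem Sj_sum_left (c' : ℝ) (D j : ℕ) {ι : Type*} (s : Finset ι) (a : ι → ℕ → ℂ)
    (a₂ : ℕ → ℂ) : Sj c' D j (∑ i ∈ s, a i) a₂ = ∑ i ∈ s, Sj c' D j (a i) a₂ := by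
  classical
  induction s using Finset.induction_on with
  | empty => simp [Sj_zero_left]
  | insert i s hi ih => rw [Finset.sum_insert hi, Finset.sum_insert hi, Sj_add_left, ih]

/-- `S_j(𝐚₁,Σᵢ 𝐚ᵢ) = Σᵢ S_j(𝐚₁,𝐚ᵢ)` for a finite family. [cite: Zhang2022LandauSiegel, §7 Prop. 7.1 p.34] -/
theorem Sj_sum_right (c' : ℝ) (D j : ℕ) {ι : Type*} (s : Finset ι) (a₁ : ℕ → ℂ)
    (a : ι → ℕ → ℂ) : Sj c' D j a₁ (∑ i ∈ s, a i) = ∑ i ∈ s, Sj c' D j a₁ (a i) := by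
  classical
  induction s using Finset.induction_on with
  | empty => simp [Sj_zero_right]
  | insert i s hi ih => rw [Finset.sum_insert hi, Finset.sum_insert hi, Sj_add_right, ih]

/-! ### Lambda forms (sequences written as `fun n => …`, as in the typed `hS` binders) -/

/-- `S_j` additive in the first slot, lambda form. [cite: Zhang2022LandauSiegel, §7 Prop. 7.1 p.34] -/
theorem Sj_add_left' (c' : ℝ) (D j : ℕ) (a₁ b₁ a₂ : ℕ → ℂ) :
    Sj c' D j (fun n => a₁ n + b₁ n) a₂ = Sj c' D j a₁ a₂ + Sj c' D j b₁ a₂ :=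
  Sj_add_left c' D j a₁ b₁ a₂

/-- `S_j` additive in the second slot, lambda form. [cite: Zhang2022LandauSiegel, §7 Prop. 7.1 p.34] -/
theorem Sj_add_right' (c' : ℝ) (D j : ℕ) (a₁ a₂ b₂ : ℕ → ℂ) :
    Sj c' D j a₁ (fun n => a₂ n + b₂ n) = Sj c' D j a₁ a₂ + Sj c' D j a₁ b₂ :=
  Sj_add_right c' D j a₁ a₂ b₂

/-- `S_j` subtractive in the first slot, lambda form. [cite: Zhang2022LandauSiegel, §7 Prop. 7.1 p.34] -/
theorem Sj_sub_left' (c' : ℝ) (D j : ℕ) (a₁ b₁ a₂ : ℕ → ℂ) :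
    Sj c' D j (fun n => a₁ n - b₁ n) a₂ = Sj c' D j a₁ a₂ - Sj c' D j b₁ a₂ :=
  Sj_sub_left c' D j a₁ b₁ a₂

/-- `S_j` subtractive in the second slot, lambda form. [cite: Zhang2022LandauSiegel, §7 Prop. 7.1 p.34] -/
theorem Sj_sub_right' (c' : ℝ) (D j : ℕ) (a₁ a₂ b₂ : ℕ → ℂ) :
    Sj c' D j a₁ (fun n => a₂ n - b₂ n) = Sj c' D j a₁ a₂ - Sj c' D j a₁ b₂ :=
  Sj_sub_right c' D j a₁ a₂ b₂

/-- Both slots at once: `S_j(𝐚₁+𝐛₁,𝐚₂+𝐛₂)` is the sum of the four pairs.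
[cite: Zhang2022LandauSiegel, §7 Prop. 7.1 p.34] -/
theorem Sj_add_add (c' : ℝ) (D j : ℕ) (a₁ b₁ a₂ b₂ : ℕ → ℂ) :
    Sj c' D j (a₁ + b₁) (a₂ + b₂) =
      Sj c' D j a₁ a₂ + Sj c' D j a₁ b₂ + (Sj c' D j b₁ a₂ + Sj c' D j b₁ b₂) := by
  rw [Sj_add_left, Sj_add_right, Sj_add_right]

/-! ### Indicator splits (`𝐚 = 𝐚·𝟙_p + 𝐚·𝟙_{¬p}`) -/

/-- **Indicator split in the first slot**: for any decidable predicate `p` on `ℕ`,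
`S_j(𝐚₁,𝐚₂) = S_j(𝐚₁𝟙_p,𝐚₂) + S_j(𝐚₁𝟙_{¬p},𝐚₂)`. [cite: Zhang2022LandauSiegel, §7 Prop. 7.1 p.34] -/
theorem Sj_ite_split_left (c' : ℝ) (D j : ℕ) (p : ℕ → Prop) [DecidablePred p] (a₁ a₂ : ℕ → ℂ) :
    Sj c' D j a₁ a₂ =
      Sj c' D j (fun n => if p n then a₁ n else 0) a₂ +
        Sj c' D j (fun n => if p n then 0 else a₁ n) a₂ := by
  rw [← Sj_add_left']
  congr 1
  funext n
  split_ifs <;> simp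

/-- **Indicator split in the second slot**: for any decidable predicate `p` on `ℕ`,
`S_j(𝐚₁,𝐚₂) = S_j(𝐚₁,𝐚₂𝟙_p) + S_j(𝐚₁,𝐚₂𝟙_{¬p})`. [cite: Zhang2022LandauSiegel, §7 Prop. 7.1 p.34] -/
theorem Sj_ite_split_right (c' : ℝ) (D j : ℕ) (p : ℕ → Prop) [DecidablePred p] (a₁ a₂ : ℕ → ℂ) :
    Sj c' D j a₁ a₂ =
      Sj c' D j a₁ (fun n => if p n then a₂ n else 0) +
        Sj c' D j a₁ (fun n => if p n then 0 else a₂ n) := by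
  rw [← Sj_add_right']
  congr 1
  funext n
  split_ifs <;> simp

end Literature.NumberTheory.LFunctions.Zhang2022.Skeleton
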